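import Summits.ValiantsHypothesis.ValiantsHypothesis.Theorems.LacunarySymmetroidMatrixDescartesCensusGardingRows

/-!
# `MatrixDescartes` census — Gårding dictionary at `(3,4)`, part 2: the middle coefficients are `tr(adj P · Y)` and `tr(adj Y · P)`

HONEST FRAMING.  Companion of `…CensusGardingRows.lean` (object-search cell `pub-symmetroid`; beside the OPEN typed statement
`DoorA34 = PosRootLawAt 3 4 18`, stmt-ValiantsHypothesis-19980).  For `3 × 3` real matrices the pencil polynomial expands as
`det (X • P + Y) = det P · X³ + tr(adj P · Y) · X² + tr(adj Y · P) · X + det Y` (`det_pencil_three_eq`), so the Gårding rows N1/N2 of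
part 1 read, for `P ≻ 0` and `Y` symmetric, `3 · det P · tr(adj Y · P) ≤ tr(adj P · Y)²` and `3 · tr(adj P · Y) · det Y ≤ tr(adj Y · P)²`
(`garding_N1_trace`, `garding_N2_trace`) — the form in which engine-2's LP34 certificates use them (`3 D(P,P,Y) = tr(adj P · Y)`,
`3 D(P,Y,Y) = tr(adj Y · P)`).  Rows for a DEFINITE letter only; nothing on the all-indefinite residue, on `ζ_sym(3,4)`, on
`MatrixDescartes` (stmt-ValiantsHypothesis-18050) or `VP ≠ VNP`.

[folklore] Expansion of a `3 × 3` determinant; elementary.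
-/

-- `Summit.ValiantsHypothesis.ValiantsHypothesis.…` repeats a component by the D-0017 layout
-- (single-conjunct summit), which the `dupNamespace` linter flags; the name is mandated.
set_option linter.dupNamespace false

namespace Summit.ValiantsHypothesis.ValiantsHypothesis.Theorems.LacunarySymmetroidMatrixDescartes.Census

open Polynomial Matrix Finset
open scoped BigOperators Polynomial Matrix

/-- **The `3 × 3` pencil polynomial, expanded**: `det (X • P + Y) = det P · X³ + tr(adj P · Y) · X² + tr(adj Y · P) · X + det Y`.
[folklore] -/
theorem det_pencil_three_eq (P Y : Matrix (Fin 3) (Fin 3) ℝ) :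
    ((X : ℝ[X]) • P.map C + Y.map C).det
      = C P.det * X ^ 3 + C (P.adjugate * Y).trace * X ^ 2 + C (Y.adjugate * P).trace * X ^ 1 + C Y.det * X ^ 0 := by
  simp only [Matrix.det_fin_three, Matrix.adjugate_fin_three, Matrix.trace_fin_three, Matrix.mul_apply,
    Fin.sum_univ_three, Matrix.add_apply, Matrix.smul_apply, Matrix.map_apply, Matrix.of_apply,
    Matrix.cons_val', Matrix.cons_val_zero, Matrix.cons_val_one, Matrix.head_cons, Matrix.cons_val_two,
    Matrix.tail_cons, Matrix.empty_val', Matrix.cons_val_fin_one, Matrix.head_fin_const, smul_eq_mul,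
    map_add, map_sub, map_mul, map_neg]
  ring

/-- The four coefficients of the `3 × 3` pencil polynomial. [folklore] -/
theorem coeff_det_pencil_three (P Y : Matrix (Fin 3) (Fin 3) ℝ) (k : ℕ) :
    (((X : ℝ[X]) • P.map C + Y.map C).det).coeff k
      = (if k = 3 then P.det else 0) + (if k = 2 then (P.adjugate * Y).trace else 0)
        + (if k = 1 then (Y.adjugate * P).trace else 0) + (if k = 0 then Y.det else 0) := by
  rw [det_pencil_three_eq]
  simp only [coeff_add, coeff_C_mul_X_pow]

/-- `coeff 2 = tr(adj P · Y)`. [folklore] -/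
theorem coeff_det_pencil_three_two (P Y : Matrix (Fin 3) (Fin 3) ℝ) :
    (((X : ℝ[X]) • P.map C + Y.map C).det).coeff 2 = (P.adjugate * Y).trace := by
  rw [coeff_det_pencil_three]; norm_num

/-- `coeff 1 = tr(adj Y · P)`. [folklore] -/
theorem coeff_det_pencil_three_one (P Y : Matrix (Fin 3) (Fin 3) ℝ) :
    (((X : ℝ[X]) • P.map C + Y.map C).det).coeff 1 = (Y.adjugate * P).trace := by
  rw [coeff_det_pencil_three]; norm_num

/-- **Row N1 in trace form**: for `P ≻ 0` and `Y` symmetric `3 × 3`, `3 · det P · tr(adj Y · P) ≤ tr(adj P · Y)²`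
(Newton `e₁² ≥ 3 e₂` for the real-rooted cubic `det (tP + Y) / det P`). [folklore] -/
theorem garding_N1_trace {P Y : Matrix (Fin 3) (Fin 3) ℝ} (hP : P.PosDef) (hY : Y.IsSymm) :
    3 * (P.det * (Y.adjugate * P).trace) ≤ (P.adjugate * Y).trace ^ 2 := by
  have h := garding_row_N1 hP hY
  rwa [coeff_det_pencil_three_one, coeff_det_pencil_three_two] at h

/-- **Row N2 in trace form**: for `P ≻ 0` and `Y` symmetric `3 × 3`, `3 · tr(adj P · Y) · det Y ≤ tr(adj Y · P)²`
(Newton `e₂² ≥ 3 e₁ e₃`). [folklore] -/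
theorem garding_N2_trace {P Y : Matrix (Fin 3) (Fin 3) ℝ} (hP : P.PosDef) (hY : Y.IsSymm) :
    3 * ((P.adjugate * Y).trace * Y.det) ≤ (Y.adjugate * P).trace ^ 2 := by
  have h := garding_row_N2 hP hY
  rwa [coeff_det_pencil_three_one, coeff_det_pencil_three_two] at h

/-- The same rows for a NEGATIVE definite letter `P` (apply N1/N2 to `−P`): `3 · det(−P) · tr(adj Y · (−P)) ≤ tr(adj(−P) · Y)²` and
`3 · tr(adj(−P) · Y) · det Y ≤ tr(adj Y · (−P))²`, stated verbatim so a certificate generator can instantiate either sign. [folklore] -/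
theorem garding_rows_trace_of_neg_posDef {P Y : Matrix (Fin 3) (Fin 3) ℝ} (hP : (-P).PosDef) (hY : Y.IsSymm) :
    3 * ((-P).det * (Y.adjugate * (-P)).trace) ≤ ((-P).adjugate * Y).trace ^ 2 ∧
      3 * (((-P).adjugate * Y).trace * Y.det) ≤ (Y.adjugate * (-P)).trace ^ 2 :=
  ⟨garding_N1_trace hP hY, garding_N2_trace hP hY⟩

end Summit.ValiantsHypothesis.ValiantsHypothesis.Theorems.LacunarySymmetroidMatrixDescartes.Census
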